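import Summits.ValiantsHypothesis.ValiantsHypothesis.Theorems.SoloBlindPlusLadderDefs

/-!
# The `+`-ladder above the permanent, II: image classes of one product term

For an ordered product `a b` (`a` ordered on the row set `A`, `|A| = k`, `b` on `Aᶜ`) that is
coefficientwise below `F_{n,n} + M · per_n`, group Alice's injective maps `τ` by their image `S`
(`clsA S = ∑ a(x_τ)`) and Bob's injective `θ` by the complement of their image
(`clsB S = ∑ b(x_θ)`).  Then

* `mass (a b) = ∑_S clsA S · clsB S` (`mass_mul_eq_sum_cls`);
* `clsA S · clsB S ≤ k!(n-k)!(1+M)` (`cls_mul_le`: at most `k!(n-k)!` pairs, coefficients `≤ 1+M`);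
* `(∑ clsA)(∑ clsB) ≤ mass (a b) + #injA · #injB` (`sum_mul_sum_le`: a non-complementary pair
  glues to a non-bijection, where the rung has coefficient `1`);

and Cauchy–Schwarz gives the key estimate `mass_term_le`:
`mass (a b) ≤ k!(n-k)!(1+M) + n! √(1+M)`.
-/

noncomputable section

open scoped NNReal Nat Classical
open MvPolynomial Finset Literature.Computability.AlgebraicComplexity

namespace Summit.ValiantsHypothesis.ValiantsHypothesis.Theorems

namespace PlusLadder

variable {n : ℕ}

/-! ### Image classes of one product term -/

section Term

variable (A : Finset (Fin n)) (a b : MvPolynomial (Fin n × Fin n) ℝ≥0) {M : ℝ≥0}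

/-- Alice's injective maps `A → [n]`. -/
def injA : Finset ({i // i ∈ A} → Fin n) := univ.filter fun τ => Function.Injective τ

/-- Bob's injective maps `Aᶜ → [n]`. -/
def injB : Finset ({i // i ∈ Aᶜ} → Fin n) := univ.filter fun θ => Function.Injective θ

/-- Alice's weights `a(x_τ)`. -/
def wA (τ : {i // i ∈ A} → Fin n) : ℝ := ((coeff (monoOf A τ) a : ℝ≥0) : ℝ)

/-- Bob's weights `b(x_θ)`. -/
def wB (θ : {i // i ∈ Aᶜ} → Fin n) : ℝ := ((coeff (monoOf Aᶜ θ) b : ℝ≥0) : ℝ)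

/-- The class sum `u_S` of Alice's injective maps with image `S`. -/
def clsA (S : Finset (Fin n)) : ℝ :=
  ∑ τ ∈ (injA A).filter (fun τ => univ.image τ = S), wA A a τ

/-- The class sum `v_S` of Bob's injective maps with image `Sᶜ`. -/
def clsB (S : Finset (Fin n)) : ℝ :=
  ∑ θ ∈ (injB A).filter (fun θ => (univ.image θ)ᶜ = S), wB A b θ

/-- Compatible injective pairs: complementary images. -/
def compatPairs : Finset (({i // i ∈ A} → Fin n) × ({i // i ∈ Aᶜ} → Fin n)) :=
  (injA A ×ˢ injB A).filter fun p => (univ.image p.2)ᶜ = univ.image p.1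

variable {A a b}

/-- Alice's weights are nonnegative. -/
theorem wA_nonneg (τ : {i // i ∈ A} → Fin n) : 0 ≤ wA A a τ := NNReal.coe_nonneg _

/-- Bob's weights are nonnegative. -/
theorem wB_nonneg (θ : {i // i ∈ Aᶜ} → Fin n) : 0 ≤ wB A b θ := NNReal.coe_nonneg _

/-- Class sums are nonnegative. -/
theorem clsA_nonneg (S : Finset (Fin n)) : 0 ≤ clsA A a S :=
  sum_nonneg fun τ _ => wA_nonneg τ

/-- Class sums are nonnegative. -/
theorem clsB_nonneg (S : Finset (Fin n)) : 0 ≤ clsB A b S :=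
  sum_nonneg fun θ _ => wB_nonneg θ

/-- The product weight of a pair is the coefficient of `a b` at the glued map. -/
theorem wA_mul_wB (ha : IsOrdered A a) (hb : IsOrdered Aᶜ b) (τ : {i // i ∈ A} → Fin n)
    (θ : {i // i ∈ Aᶜ} → Fin n) :
    wA A a τ * wB A b θ =
      ((coeff (monoMap ((splitEquiv A).symm (τ, θ))) (a * b) : ℝ≥0) : ℝ) := by
  rw [wA, wB, coeff_glue ha hb, NNReal.coe_mul]

/-- `μ(ab)` as a sum over compatible injective pairs. -/
theorem mass_mul_eq_sum_pairs (ha : IsOrdered A a) (hb : IsOrdered Aᶜ b) :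
    mass (a * b) = ∑ p ∈ compatPairs A, wA A a p.1 * wB A b p.2 := by
  unfold mass compatPairs
  rw [← Equiv.sum_comp (splitEquiv A).symm, Finset.sum_filter]
  have huniv : (injA A ×ˢ injB A) = univ.filter
      (fun p : ({i // i ∈ A} → Fin n) × ({i // i ∈ Aᶜ} → Fin n) =>
        Function.Injective p.1 ∧ Function.Injective p.2) := by
    ext p
    simp only [injA, injB, mem_product, mem_filter, mem_univ, true_and]
  rw [huniv, Finset.sum_filter]
  refine sum_congr rfl ?_
  rintro ⟨τ, θ⟩ -
  have key := bijective_glue_iff A τ θ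
  dsimp only
  by_cases h1 : Function.Bijective ((splitEquiv A).symm (τ, θ))
  · obtain ⟨hτ, hθ, hc⟩ := key.1 h1
    rw [if_pos h1, if_pos ⟨hτ, hθ⟩, if_pos hc, wA_mul_wB ha hb]
  · rw [if_neg h1]
    by_cases h2 : Function.Injective τ ∧ Function.Injective θ
    · rw [if_pos h2, if_neg (fun hc => h1 (key.2 ⟨h2.1, h2.2, hc⟩))]
    · rw [if_neg h2]

/-- `μ(ab) = ∑_S u_S v_S`. -/
theorem mass_mul_eq_sum_cls (ha : IsOrdered A a) (hb : IsOrdered Aᶜ b) :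
    mass (a * b) = ∑ S, clsA A a S * clsB A b S := by
  rw [mass_mul_eq_sum_pairs ha hb,
    ← Finset.sum_fiberwise_of_maps_to (s := compatPairs A) (t := univ)
      (g := fun p => univ.image p.1) (fun _ _ => mem_univ _)]
  refine sum_congr rfl fun S _ => ?_
  have hset : (compatPairs A).filter (fun p => univ.image p.1 = S) =
      ((injA A).filter fun τ => univ.image τ = S) ×ˢ
        ((injB A).filter fun θ => (univ.image θ)ᶜ = S) := by
    ext ⟨τ, θ⟩
    simp only [compatPairs, mem_filter, mem_product]
    constructor
    · rintro ⟨⟨⟨hI, hJ⟩, hc⟩, hS⟩; exact ⟨⟨hI, hS⟩, hJ, hc.trans hS⟩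
    · rintro ⟨⟨hI, hS⟩, hJ, hc⟩; exact ⟨⟨⟨hI, hJ⟩, hc.trans hS.symm⟩, hS⟩
  rw [clsA, clsB, Finset.sum_mul_sum, ← Finset.sum_product']
  exact sum_congr hset fun _ _ => rfl

/-- Summing Alice's classes recovers the sum over all her injective maps. -/
theorem sum_clsA : ∑ S, clsA A a S = ∑ τ ∈ injA A, wA A a τ := by
  unfold clsA
  exact Finset.sum_fiberwise_of_maps_to (s := injA A) (t := univ) (g := fun τ => univ.image τ)
    (fun _ _ => mem_univ _) (wA A a)

/-- Summing Bob's classes recovers the sum over all his injective maps. -/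
theorem sum_clsB : ∑ S, clsB A b S = ∑ θ ∈ injB A, wB A b θ := by
  unfold clsB
  exact Finset.sum_fiberwise_of_maps_to (s := injB A) (t := univ)
    (g := fun θ => (univ.image θ)ᶜ) (fun _ _ => mem_univ _) (wB A b)

/-- `#injA ≤ n^{(k)}`. -/
theorem card_injA_le : (injA A).card ≤ n.descFactorial A.card :=
  card_filter_injective_le A

/-- `#injB ≤ n^{(n-k)}`. -/
theorem card_injB_le : (injB A).card ≤ n.descFactorial (n - A.card) := by
  have h := card_filter_injective_le Aᶜ
  rw [card_compl, Fintype.card_fin] at h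
  exact h

/-- Each class product is at most `k! (n-k)! (1+M)`. -/
theorem cls_mul_le (ha : IsOrdered A a) (hb : IsOrdered Aᶜ b)
    (hle : ∀ m, coeff m (a * b) ≤ coeff m (ladder n M)) (S : Finset (Fin n)) :
    clsA A a S * clsB A b S ≤ (A.card ! * (n - A.card) ! : ℝ) * (1 + M) := by
  have hw : ∀ τ θ, wA A a τ * wB A b θ ≤ 1 + (M : ℝ) := fun τ θ => by
    rw [wA_mul_wB ha hb]
    exact_mod_cast (hle _).trans (coeff_monoMap_ladder_le M _)
  have hI : (((injA A).filter fun τ => univ.image τ = S).card : ℝ) ≤ A.card ! := by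
    exact_mod_cast card_filter_injective_image_le A S
  have hJ : (((injB A).filter fun θ => (univ.image θ)ᶜ = S).card : ℝ) ≤ (n - A.card) ! := by
    have h := card_filter_injective_image_le Aᶜ Sᶜ
    rw [card_compl, Fintype.card_fin] at h
    have hset : ((injB A).filter fun θ => (univ.image θ)ᶜ = S) =
        (injB A).filter fun θ => univ.image θ = Sᶜ :=
      Finset.filter_congr fun θ _ =>
        ⟨fun h1 => by rw [← h1, compl_compl], fun h1 => by rw [h1, compl_compl]⟩
    rw [hset]
    exact_mod_cast h
  have h0 : (0 : ℝ) ≤ 1 + (M : ℝ) := by positivity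
  calc clsA A a S * clsB A b S
      = ∑ τ ∈ (injA A).filter (fun τ => univ.image τ = S),
          ∑ θ ∈ (injB A).filter (fun θ => (univ.image θ)ᶜ = S), wA A a τ * wB A b θ := by
        rw [clsA, clsB, Finset.sum_mul_sum]
    _ ≤ ∑ τ ∈ (injA A).filter (fun τ => univ.image τ = S),
          ∑ θ ∈ (injB A).filter (fun θ => (univ.image θ)ᶜ = S), (1 + (M : ℝ)) :=
        sum_le_sum fun τ _ => sum_le_sum fun θ _ => hw τ θ
    _ = ((injA A).filter fun τ => univ.image τ = S).card *
          ((((injB A).filter fun θ => (univ.image θ)ᶜ = S).card) * (1 + (M : ℝ))) := by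
        rw [sum_const, sum_const, nsmul_eq_mul, nsmul_eq_mul]
    _ ≤ A.card ! * ((n - A.card) ! * (1 + (M : ℝ))) := by gcongr
    _ = _ := by ring

/-- `(∑ u_S)(∑ v_S) ≤ μ(ab) + #injA · #injB` (cross pairs glue to non-bijections). -/
theorem sum_mul_sum_le (ha : IsOrdered A a) (hb : IsOrdered Aᶜ b)
    (hle : ∀ m, coeff m (a * b) ≤ coeff m (ladder n M)) :
    (∑ S, clsA A a S) * (∑ S, clsB A b S) ≤
      mass (a * b) + ((injA A).card : ℝ) * (injB A).card := by
  rw [sum_clsA, sum_clsB, Finset.sum_mul_sum, ← Finset.sum_product', mass_mul_eq_sum_pairs ha hb,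
    compatPairs, ← Finset.sum_filter_add_sum_filter_not (injA A ×ˢ injB A)
      (fun p => (univ.image p.2)ᶜ = univ.image p.1)]
  have hcross : ∑ p ∈ (injA A ×ˢ injB A).filter
      (fun p => ¬ (univ.image p.2)ᶜ = univ.image p.1),
      wA A a p.1 * wB A b p.2 ≤ ((injA A).card : ℝ) * (injB A).card := by
    calc ∑ p ∈ (injA A ×ˢ injB A).filter (fun p => ¬ (univ.image p.2)ᶜ = univ.image p.1),
          wA A a p.1 * wB A b p.2
        ≤ ∑ p ∈ (injA A ×ˢ injB A).filter (fun p => ¬ (univ.image p.2)ᶜ = univ.image p.1),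
          (1 : ℝ) := by
          refine sum_le_sum ?_
          rintro ⟨τ, θ⟩ hp
          simp only [mem_filter, mem_product, injA, injB, mem_univ, true_and] at hp
          obtain ⟨⟨hτ, hθ⟩, hnc⟩ := hp
          have hnb : ¬ Function.Bijective ((splitEquiv A).symm (τ, θ)) := fun hb' =>
            hnc ((bijective_glue_iff A τ θ).1 hb').2.2
          show wA A a τ * wB A b θ ≤ 1
          rw [wA_mul_wB ha hb]
          exact_mod_cast (hle _).trans (coeff_monoMap_ladder_of_not_bijective M hnb).le
      _ = ((injA A ×ˢ injB A).filter
            (fun p => ¬ (univ.image p.2)ᶜ = univ.image p.1)).card := by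
          rw [sum_const, nsmul_eq_mul, mul_one]
      _ ≤ ((injA A ×ˢ injB A)).card := by exact_mod_cast card_filter_le _ _
      _ = ((injA A).card : ℝ) * (injB A).card := by rw [card_product, Nat.cast_mul]
  linarith

/-- **Key estimate.** For an ordered product `a b ≤ F + M per` with `|A| = k`:
`μ(ab) ≤ k! (n-k)! (1+M) + n! √(1+M)`. -/
theorem mass_term_le (ha : IsOrdered A a) (hb : IsOrdered Aᶜ b)
    (hle : ∀ m, coeff m (a * b) ≤ coeff m (ladder n M)) :
    mass (a * b) ≤ (A.card ! * (n - A.card) ! : ℝ) * (1 + M) + n ! * Real.sqrt (1 + M) := by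
  set k := A.card with hk
  set Z : ℝ := (k ! * (n - k) ! : ℝ) * (1 + M) with hZ
  set N : ℝ := ((injA A).card : ℝ) * (injB A).card with hN
  have hZ0 : 0 ≤ Z := by positivity
  have hN0 : 0 ≤ N := by positivity
  have u0 : ∀ S, 0 ≤ clsA A a S := fun S => clsA_nonneg S
  have v0 : ∀ S, 0 ≤ clsB A b S := fun S => clsB_nonneg S
  have hμS : mass (a * b) = ∑ S, clsA A a S * clsB A b S := mass_mul_eq_sum_cls ha hb
  have hpZ : ∀ S, clsA A a S * clsB A b S ≤ Z := fun S => cls_mul_le ha hb hle S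
  -- Cauchy–Schwarz
  have hCS : (∑ S, Real.sqrt (clsA A a S * clsB A b S)) ^ 2 ≤
      (∑ S, clsA A a S) * (∑ S, clsB A b S) := by
    have h := Finset.sum_mul_sq_le_sq_mul_sq (univ : Finset (Finset (Fin n)))
      (fun S => Real.sqrt (clsA A a S)) (fun S => Real.sqrt (clsB A b S))
    have e1 : ∀ S, Real.sqrt (clsA A a S) * Real.sqrt (clsB A b S) =
        Real.sqrt (clsA A a S * clsB A b S) := fun S => (Real.sqrt_mul (u0 S) _).symm
    have e2 : ∀ S, Real.sqrt (clsA A a S) ^ 2 = clsA A a S := fun S => Real.sq_sqrt (u0 S)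
    have e3 : ∀ S, Real.sqrt (clsB A b S) ^ 2 = clsB A b S := fun S => Real.sq_sqrt (v0 S)
    simp only [e1, e2, e3] at h
    exact h
  have hUV := sum_mul_sum_le ha hb hle
  -- μ ≤ √Z Σ √p_S
  have hμ_le : mass (a * b) ≤ Real.sqrt Z * ∑ S, Real.sqrt (clsA A a S * clsB A b S) := by
    rw [hμS, Finset.mul_sum]
    refine sum_le_sum fun S _ => ?_
    have hp0 : 0 ≤ clsA A a S * clsB A b S := mul_nonneg (u0 S) (v0 S)
    calc clsA A a S * clsB A b S
        = Real.sqrt (clsA A a S * clsB A b S) * Real.sqrt (clsA A a S * clsB A b S) :=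
          (Real.mul_self_sqrt hp0).symm
      _ ≤ Real.sqrt Z * Real.sqrt (clsA A a S * clsB A b S) :=
          mul_le_mul_of_nonneg_right (Real.sqrt_le_sqrt (hpZ S)) (Real.sqrt_nonneg _)
  have hμ0 : 0 ≤ mass (a * b) := by
    rw [hμS]; exact sum_nonneg fun S _ => mul_nonneg (u0 S) (v0 S)
  have hsq : mass (a * b) ^ 2 ≤ Z * mass (a * b) + Z * N := by
    calc mass (a * b) ^ 2
        ≤ (Real.sqrt Z * ∑ S, Real.sqrt (clsA A a S * clsB A b S)) ^ 2 :=
          pow_le_pow_left₀ hμ0 hμ_le 2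
      _ = Z * (∑ S, Real.sqrt (clsA A a S * clsB A b S)) ^ 2 := by
          rw [mul_pow, Real.sq_sqrt hZ0]
      _ ≤ Z * ((∑ S, clsA A a S) * (∑ S, clsB A b S)) := mul_le_mul_of_nonneg_left hCS hZ0
      _ ≤ Z * (mass (a * b) + N) := mul_le_mul_of_nonneg_left hUV hZ0
      _ = Z * mass (a * b) + Z * N := by ring
  have hfin := le_add_sqrt_of_sq_le hZ0 hN0 hsq
  -- Z N ≤ (1+M) (n!)²
  have hkn : k ≤ n := by
    rw [hk]; exact (card_le_univ A).trans (by rw [Fintype.card_fin])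
  have hZN : Z * N ≤ (1 + (M : ℝ)) * ((n ! : ℝ) * n !) := by
    have hI : ((injA A).card : ℝ) ≤ n.descFactorial k := by exact_mod_cast card_injA_le
    have hJ : ((injB A).card : ℝ) ≤ n.descFactorial (n - k) := by exact_mod_cast card_injB_le
    have e1 : ((n - k) ! : ℝ) * n.descFactorial k = n ! := by
      exact_mod_cast Nat.factorial_mul_descFactorial hkn
    have e2 : (k ! : ℝ) * n.descFactorial (n - k) = n ! := by
      have := Nat.factorial_mul_descFactorial (Nat.sub_le n k)
      rw [Nat.sub_sub_self hkn] at this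
      exact_mod_cast this
    have h0 : (0 : ℝ) ≤ 1 + (M : ℝ) := by positivity
    calc Z * N = (1 + (M : ℝ)) * ((k ! : ℝ) * (n - k) ! * ((injA A).card * (injB A).card)) := by
          rw [hZ, hN]; ring
      _ ≤ (1 + (M : ℝ)) * ((k ! : ℝ) * (n - k) ! *
            (n.descFactorial k * n.descFactorial (n - k))) := by gcongr
      _ = (1 + (M : ℝ)) * ((((n - k) ! : ℝ) * n.descFactorial k) *
            ((k ! : ℝ) * n.descFactorial (n - k))) := by ring
      _ = (1 + (M : ℝ)) * ((n ! : ℝ) * n !) := by rw [e1, e2]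
  have hsqrtZN : Real.sqrt (Z * N) ≤ n ! * Real.sqrt (1 + M) := by
    calc Real.sqrt (Z * N) ≤ Real.sqrt ((1 + (M : ℝ)) * ((n ! : ℝ) * n !)) :=
          Real.sqrt_le_sqrt hZN
      _ = Real.sqrt (1 + (M : ℝ)) * Real.sqrt ((n ! : ℝ) * n !) :=
          Real.sqrt_mul (by positivity) _
      _ = n ! * Real.sqrt (1 + M) := by
          rw [Real.sqrt_mul_self (by positivity)]; ring
  calc mass (a * b) ≤ Z + Real.sqrt (Z * N) := hfin
    _ ≤ Z + n ! * Real.sqrt (1 + M) := add_le_add le_rfl hsqrtZN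

end Term

end PlusLadder

end Summit.ValiantsHypothesis.ValiantsHypothesis.Theorems
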